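import Literature.Probability.RandomPlanarGeometry.BrownianLoopMassCore
import Literature.Probability.RandomPlanarGeometry.BrownianLoopMassReduction
import Literature.Probability.Process.BrownianRunningSupFourthMoment
import Mathlib.MeasureTheory.Integral.IntegralEqImproper
import Mathlib.Analysis.SpecialFunctions.Pow.Deriv
import Mathlib.Analysis.SpecialFunctions.Pow.Asymptotics
import HarnessLib

/-!
# Finiteness of the Brownian loop mass `Λ(K₁, K₂; D)` — discharge of `loopMass_lt_top`

Proof file for the named fact `loopMass_lt_top` of `BrownianLoopMeasure` ([Lawler2009] §2.2,
p. 6 of the paper: "If `K₁` is bounded, `dist(K₁, K₂) > 0`, and `∂D` is nonpolar, then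
`Λ(K₁, K₂; D) < ∞`", vendored for `D` whose complement contains a disc `B(z₀, r)`). The paper
states the fact without proof; we give the classical two-scale argument.

With `base = area ⊗ 𝟙_{t>0}dt/(2πt²) ⊗ ℙ` and the rooted loop `z + √t b` (`b` the unit planar
bridge), `Λ(K₁, K₂; D) ≤ base(E)` for the rooted event "hits `K̄₁`, hits `K̄₂`, avoids `B(z₀, r)`"
(`loopMass_le_base_bridgeEvent`), and by Tonelli and Brownian scaling of the root
(`base_eq_lintegral`, `volume_section_eq_mul_volume_scaled`),

  `base(E) = ∫₀^∞ (1/(2πt²)) · t · E|{w : (w + b) hits t^{-1/2}K̄₁, hits t^{-1/2}K̄₂, avoids t^{-1/2}B(z₀,r)}| dt`.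

* SMALL loops (`t ≤ T₀`): a loop hitting two sets at distance `δ` has amplitude `≳ δ`, so the
  integrand is `O(m⁴)` uniformly in `t` (`volume_scaled_le_of_small`, `m` the running supremum of the
  pair), and `E[m⁴] < ∞` (`Process.lintegral_runSup_pow_four_le`, Doob's inequality);
* LARGE loops (`t ≥ T₀`): the integrand is `(1/(2πt)) · O((log t)^{-9/8})`
  (`lintegral_volume_bridge_hit_avoid_le_log_rpow`: a loop of duration `t` coming `O(1)`-close to
  `K₁` from a root at distance `≍ √t` costs `1/log t` through the expected sausage area, and then
  avoiding the `O(1)`-disc `B(z₀, r) ⊆ Dᶜ` costs another `1/log t`; the crude sausage bound loses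
  `(log t)^{7/8}`), and `∫^∞ (log t)^{-9/8} dt/t < ∞` (`lintegral_Ioi_log_rpow_div_lt_top`).

Main result: `loopMass_lt_top_holds : loopMass_lt_top`. No definition and no named fact is introduced.

## References

* G. F. Lawler, *Partition functions, loop measure, and versions of SLE*, J. Stat. Phys. 134 (2009)
  813–837, §2.2 (p. 6). [Lawler2009]
* G. F. Lawler, W. Werner, *The Brownian loop soup*, PTRF 128 (2004), §4. [LawlerWerner2004]
-/

noncomputable section

open MeasureTheory ProbabilityTheory Filter Set Metric Complex
open scoped NNReal ENNReal Topology Pointwise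

namespace Literature.Probability.RandomPlanarGeometry

open Literature.Probability.Process
open BrownianLoop UnbasedLoop

/-! ### The logarithmic integral at infinity -/

/-- **`∫_{T₀}^∞ (log t)^{-9/8} dt/t < ∞`** for `T₀ > 1`: the integrand is the derivative of
`−8 (log t)^{-1/8}`, which increases to `0` at infinity (Mathlib `integrableOn_Ioi_deriv_of_nonneg'`).
[folklore] -/
theorem lintegral_Ioi_log_rpow_div_lt_top {T₀ : ℝ} (hT₀ : 1 < T₀) :
    ∫⁻ t in Ioi T₀, ENNReal.ofReal (Real.log t ^ (-(9 : ℝ) / 8) / t) < ∞ := by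
  set g : ℝ → ℝ := fun t ↦ -8 * Real.log t ^ (-(1 : ℝ) / 8) with hg
  have hderiv : ∀ t ∈ Ici T₀, HasDerivAt g (Real.log t ^ (-(9 : ℝ) / 8) / t) t := by
    intro t ht
    have ht0 : 0 < t := lt_of_lt_of_le (by linarith) ht
    have hlog : 0 < Real.log t := Real.log_pos (lt_of_lt_of_le hT₀ ht)
    have h1 := ((Real.hasDerivAt_log ht0.ne').rpow_const (p := -(1 : ℝ) / 8) (Or.inl hlog.ne')).const_mul (-8)
    refine h1.congr_deriv ?_
    rw [show -(1 : ℝ) / 8 - 1 = -(9 : ℝ) / 8 by norm_num]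
    field_simp
  have hpos : ∀ t ∈ Ioi T₀, 0 ≤ Real.log t ^ (-(9 : ℝ) / 8) / t := fun t ht ↦ by
    have ht0 : 0 < t := lt_trans (by linarith) ht
    have hlog : 0 < Real.log t := Real.log_pos (lt_trans hT₀ ht)
    positivity
  have hlim : Tendsto g atTop (𝓝 0) := by
    have h1 : Tendsto (fun t : ℝ ↦ Real.log t ^ (-((1 : ℝ) / 8))) atTop (𝓝 0) :=
      (tendsto_rpow_neg_atTop (by norm_num : (0 : ℝ) < 1 / 8)).comp Real.tendsto_log_atTop
    have h2 : g = fun t ↦ -8 * Real.log t ^ (-((1 : ℝ) / 8)) := by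
      funext t; simp only [hg]; congr 2; ring
    rw [h2, show (0 : ℝ) = -8 * 0 by ring]
    exact h1.const_mul (-8)
  have hint := integrableOn_Ioi_deriv_of_nonneg' hderiv hpos hlim
  exact hint.setLIntegral_lt_top

/-! ### The main theorem -/

/-- **Finiteness of the Brownian loop mass `Λ(K₁, K₂; D)`** ([Lawler2009] §2.2): discharge of the
named fact `loopMass_lt_top` of `BrownianLoopMeasure` — for `D` open whose complement contains a
disc `B(z₀, r)`, `K₁` bounded and `dist(K₁, K₂) ≥ δ > 0`, `Λ(K₁, K₂; D) < ∞`.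
[cite: Lawler2009, §2.2 (finiteness of Λ(K₁,K₂;D), stated p. 6)] -/
theorem loopMass_lt_top_holds : loopMass_lt_top := by
  intro D K₁ K₂ hD hball hK₁ hdist
  obtain ⟨z₀, r, hr, hdisj⟩ := hball
  obtain ⟨δ, hδ, hdist⟩ := hdist
  -- closures, a radius `R`
  set K : Set ℂ := closure K₁ with hKdef
  set K' : Set ℂ := closure K₂ with hK'def
  have hK : IsClosed K := isClosed_closure
  have hK' : IsClosed K' := isClosed_closure
  obtain ⟨R₀, hR₀⟩ := (Metric.isBounded_iff_subset_closedBall (0 : ℂ)).1 hK₁.closure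
  set R : ℝ := max R₀ 0 with hRdef
  have hR : 0 ≤ R := le_max_right _ _
  have hKR : K ⊆ closedBall 0 R := hR₀.trans (closedBall_subset_closedBall (le_max_left _ _))
  have hdist' : ∀ x ∈ K, ∀ y ∈ K', δ ≤ dist x y := by
    have hcl : IsClosed {p : ℂ × ℂ | δ ≤ dist p.1 p.2} := isClosed_le continuous_const continuous_dist
    have hsub : K₁ ×ˢ K₂ ⊆ {p : ℂ × ℂ | δ ≤ dist p.1 p.2} := fun p hp ↦ hdist p.1 hp.1 p.2 hp.2
    have := (closure_minimal hsub hcl)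
    rw [closure_prod_eq] at this
    exact fun x hx y hy ↦ this (⟨hx, hy⟩ : (x, y) ∈ closure K₁ ×ˢ closure K₂)
  set O : Set ℂ := ball z₀ r with hOdef
  have hO : IsOpen O := isOpen_ball
  -- Step 1: the rooted event
  set E : Set (ℂ × ℝ × WienerPair) := {p : ℂ × ℝ × WienerPair |
      (∃ s : ℝ≥0, s ≤ 1 ∧ p.1 + (Real.sqrt p.2.1 : ℂ) * (planarBrownian s p.2.2 - (s : ℝ) • planarBrownian 1 p.2.2) ∈ K) ∧
      (∃ s : ℝ≥0, s ≤ 1 ∧ p.1 + (Real.sqrt p.2.1 : ℂ) * (planarBrownian s p.2.2 - (s : ℝ) • planarBrownian 1 p.2.2) ∈ K') ∧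
      ∀ s : ℝ≥0, s ≤ 1 → p.1 + (Real.sqrt p.2.1 : ℂ) * (planarBrownian s p.2.2 - (s : ℝ) • planarBrownian 1 p.2.2) ∉ O}
    with hEdef
  have hE : MeasurableSet E := measurableSet_bridgeEvent hK hK' hO
  have hstep1 : loopMass D K₁ K₂ ≤ base E :=
    (loopMass_mono subset_closure subset_closure).trans (loopMass_le_base_bridgeEvent hD hdisj hK hK')
  refine lt_of_le_of_lt hstep1 ?_
  -- Step 2: Tonelli, scaling
  rw [base_eq_lintegral hE]
  set V : ℝ → WienerPair → ℝ≥0∞ := fun t ω ↦ volume {w : ℂ |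
      (∃ s : ℝ≥0, s ≤ 1 ∧ w + (planarBrownian s ω - (s : ℝ) • planarBrownian 1 ω) ∈ (Real.sqrt t)⁻¹ • K) ∧
      (∃ s : ℝ≥0, s ≤ 1 ∧ w + (planarBrownian s ω - (s : ℝ) • planarBrownian 1 ω) ∈ (Real.sqrt t)⁻¹ • K') ∧
      ∀ s : ℝ≥0, s ≤ 1 → w + (planarBrownian s ω - (s : ℝ) • planarBrownian 1 ω) ∉ (Real.sqrt t)⁻¹ • O} with hVdef
  have hsec : ∀ t ∈ Ioi (0 : ℝ), ∀ ω : WienerPair,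
      volume ((fun z : ℂ ↦ (z, (t, ω))) ⁻¹' E) = ENNReal.ofReal t * V t ω := by
    intro t ht ω
    have := volume_section_eq_mul_volume_scaled K K' O ht ω
    simpa [hEdef, hVdef] using this
  have hcongr : ∫⁻ t in Ioi 0, timeDensity t * ∫⁻ ω, volume ((fun z : ℂ ↦ (z, (t, ω))) ⁻¹' E) ∂wienerPair =
      ∫⁻ t in Ioi 0, timeDensity t * ∫⁻ ω, ENNReal.ofReal t * V t ω ∂wienerPair := by
    refine setLIntegral_congr_fun measurableSet_Ioi fun t ht ↦ ?_
    simp_rw [hsec t ht]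
  rw [hcongr]
  -- the large-time threshold from the core estimate
  obtain ⟨T₀, hT₀, C, hC0, hcore⟩ := lintegral_volume_bridge_hit_avoid_le_log_rpow hR hr z₀
  have hT₀pos : 0 < T₀ := by linarith
  -- split the time integral
  have hsplit : Ioi (0 : ℝ) = Ioc 0 T₀ ∪ Ioi T₀ := (Ioc_union_Ioi_eq_Ioi hT₀pos.le).symm
  rw [hsplit, lintegral_union measurableSet_Ioi (Ioc_disjoint_Ioi le_rfl)]
  refine ENNReal.add_lt_top.2 ⟨?_, ?_⟩
  ----------------------------------------------------------------
  -- SMALL loops: `t ∈ (0, T₀]`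
  ----------------------------------------------------------------
  · set c₀ : ℝ := 2 ^ 12 * R ^ 2 / δ ^ 4 + 2 ^ 10 / δ ^ 2 with hc₀
    have hc₀0 : 0 ≤ c₀ := by positivity
    -- pointwise in `(t, ω)`
    have hpt : ∀ t ∈ Ioc (0 : ℝ) T₀, timeDensity t * ∫⁻ ω, ENNReal.ofReal t * V t ω ∂wienerPair ≤
        ∫⁻ ω, ENNReal.ofReal (c₀ * max (runSup 1 ω.1) (runSup 1 ω.2) ^ 4) ∂wienerPair := by
      intro t ht
      have htd : timeDensity t ≠ ∞ := ENNReal.ofReal_ne_top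
      rw [← lintegral_const_mul' (timeDensity t) _ htd]
      refine lintegral_mono fun ω ↦ ?_
      exact volume_scaled_le_of_small O hR hδ hKR hdist' ht.1 ω
    -- the fourth moment of the running supremum of the pair
    have hm4 : ∫⁻ ω, ENNReal.ofReal (c₀ * max (runSup 1 ω.1) (runSup 1 ω.2) ^ 4) ∂wienerPair < ∞ := by
      have hle : ∀ ω : WienerPair, ENNReal.ofReal (c₀ * max (runSup 1 ω.1) (runSup 1 ω.2) ^ 4) ≤
          ENNReal.ofReal c₀ * (ENNReal.ofReal (runSup 1 ω.1 ^ 4) + ENNReal.ofReal (runSup 1 ω.2 ^ 4)) := by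
        intro ω
        rw [← ENNReal.ofReal_add (by positivity) (by positivity), ← ENNReal.ofReal_mul hc₀0]
        refine ENNReal.ofReal_le_ofReal (mul_le_mul_of_nonneg_left ?_ hc₀0)
        have h1 := runSup_nonneg 1 ω.1
        have h2 := runSup_nonneg 1 ω.2
        rcases le_total (runSup 1 ω.1) (runSup 1 ω.2) with h | h
        · rw [max_eq_right h]; nlinarith [pow_nonneg h1 4]
        · rw [max_eq_left h]; nlinarith [pow_nonneg h2 4]
      refine lt_of_le_of_lt (lintegral_mono hle) ?_
      have hf : Measurable fun ω : WienerPair ↦ ENNReal.ofReal (runSup 1 ω.1 ^ 4) :=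
        ENNReal.measurable_ofReal.comp (((measurable_runSup 1).comp measurable_fst).pow_const 4)
      rw [lintegral_const_mul' _ _ ENNReal.ofReal_ne_top, lintegral_add_left hf]
      refine ENNReal.mul_lt_top ENNReal.ofReal_lt_top (ENNReal.add_lt_top.2 ⟨?_, ?_⟩)
      · have : ∫⁻ ω : WienerPair, ENNReal.ofReal (runSup 1 ω.1 ^ 4) ∂wienerPair =
            ∫⁻ ω₁, ENNReal.ofReal (runSup 1 ω₁ ^ 4) ∂preWienerMeasure := by
          haveI := RandomPlanarGeometry.isProbabilityMeasure_preWienerMeasure'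
          have hg : Measurable fun ω₁ : ℝ≥0 → ℝ ↦ ENNReal.ofReal (runSup 1 ω₁ ^ 4) :=
            ENNReal.measurable_ofReal.comp ((measurable_runSup 1).pow_const 4)
          rw [← lintegral_map hg measurable_fst, wienerPair, Measure.map_fst_prod, measure_univ, one_smul]
        rw [this]
        exact lt_of_le_of_lt (lintegral_runSup_pow_four_le 1) ENNReal.ofReal_lt_top
      · have : ∫⁻ ω : WienerPair, ENNReal.ofReal (runSup 1 ω.2 ^ 4) ∂wienerPair =
            ∫⁻ ω₂, ENNReal.ofReal (runSup 1 ω₂ ^ 4) ∂preWienerMeasure := by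
          haveI := RandomPlanarGeometry.isProbabilityMeasure_preWienerMeasure'
          have hg : Measurable fun ω₂ : ℝ≥0 → ℝ ↦ ENNReal.ofReal (runSup 1 ω₂ ^ 4) :=
            ENNReal.measurable_ofReal.comp ((measurable_runSup 1).pow_const 4)
          rw [← lintegral_map hg measurable_snd, wienerPair, Measure.map_snd_prod, measure_univ, one_smul]
        rw [this]
        exact lt_of_le_of_lt (lintegral_runSup_pow_four_le 1) ENNReal.ofReal_lt_top
    calc ∫⁻ t in Ioc 0 T₀, timeDensity t * ∫⁻ ω, ENNReal.ofReal t * V t ω ∂wienerPair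
        ≤ ∫⁻ _ in Ioc (0 : ℝ) T₀, ∫⁻ ω, ENNReal.ofReal (c₀ * max (runSup 1 ω.1) (runSup 1 ω.2) ^ 4) ∂wienerPair :=
          setLIntegral_mono measurable_const hpt
      _ = (∫⁻ ω, ENNReal.ofReal (c₀ * max (runSup 1 ω.1) (runSup 1 ω.2) ^ 4) ∂wienerPair) * volume (Ioc (0 : ℝ) T₀) :=
          setLIntegral_const _ _
      _ < ∞ := ENNReal.mul_lt_top hm4 (by rw [Real.volume_Ioc]; exact ENNReal.ofReal_lt_top)
  ----------------------------------------------------------------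
  -- LARGE loops: `t > T₀`
  ----------------------------------------------------------------
  · -- drop `K'`, compare the scaled sets with discs
    have hV : ∀ t ∈ Ioi T₀, ∀ ω : WienerPair, V t ω ≤ volume {w : ℂ | (∃ s : ℝ≥0, s ≤ 1 ∧
        w + (planarBrownian s ω - (s : ℝ) • planarBrownian 1 ω) ∈ closedBall 0 ((Real.sqrt t)⁻¹ * R)) ∧
        ∀ s : ℝ≥0, s ≤ 1 → w + (planarBrownian s ω - (s : ℝ) • planarBrownian 1 ω) ∉
          ball ((Real.sqrt t)⁻¹ • z₀) ((Real.sqrt t)⁻¹ * r)} := by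
      intro t ht ω
      have ht0 : 0 < t := lt_trans hT₀pos ht
      have hc0 : 0 < (Real.sqrt t)⁻¹ := inv_pos.2 (Real.sqrt_pos.2 ht0)
      refine measure_mono ?_
      rintro w ⟨⟨s, hs, hsK⟩, -, havoid⟩
      refine ⟨⟨s, hs, ?_⟩, fun s' hs' hmem ↦ havoid s' hs' ?_⟩
      · obtain ⟨x, hx, hxeq⟩ := hsK
        rw [← hxeq, mem_closedBall, dist_zero_right, norm_smul, Real.norm_eq_abs, abs_of_pos hc0]
        exact mul_le_mul_of_nonneg_left (by simpa [mem_closedBall, dist_zero_right] using hKR hx) hc0.le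
      · rw [hOdef, _root_.smul_ball hc0.ne', Real.norm_eq_abs, abs_of_pos hc0]
        exact hmem
    have hpt : ∀ t ∈ Ioi T₀, timeDensity t * ∫⁻ ω, ENNReal.ofReal t * V t ω ∂wienerPair ≤
        ENNReal.ofReal (C / (2 * Real.pi) * (Real.log t ^ (-(9 : ℝ) / 8) / t)) := by
      intro t ht
      have ht0 : 0 < t := lt_trans hT₀pos ht
      have h1 : ∫⁻ ω, ENNReal.ofReal t * V t ω ∂wienerPair ≤ ENNReal.ofReal t * ENNReal.ofReal (C * Real.log t ^ (-(9 : ℝ) / 8)) := by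
        rw [lintegral_const_mul' _ _ ENNReal.ofReal_ne_top]
        gcongr
        exact (lintegral_mono (hV t ht)).trans (hcore t ht.le)
      calc timeDensity t * ∫⁻ ω, ENNReal.ofReal t * V t ω ∂wienerPair
          ≤ timeDensity t * (ENNReal.ofReal t * ENNReal.ofReal (C * Real.log t ^ (-(9 : ℝ) / 8))) := by gcongr
        _ = ENNReal.ofReal (C / (2 * Real.pi) * (Real.log t ^ (-(9 : ℝ) / 8) / t)) := by
            rw [timeDensity, ← ENNReal.ofReal_mul ht0.le, ← ENNReal.ofReal_mul (by positivity)]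
            congr 1
            field_simp
    calc ∫⁻ t in Ioi T₀, timeDensity t * ∫⁻ ω, ENNReal.ofReal t * V t ω ∂wienerPair
        ≤ ∫⁻ t in Ioi T₀, ENNReal.ofReal (C / (2 * Real.pi) * (Real.log t ^ (-(9 : ℝ) / 8) / t)) :=
          setLIntegral_mono (by fun_prop) hpt
      _ = ENNReal.ofReal (C / (2 * Real.pi)) * ∫⁻ t in Ioi T₀, ENNReal.ofReal (Real.log t ^ (-(9 : ℝ) / 8) / t) := by
          rw [← lintegral_const_mul' _ _ ENNReal.ofReal_ne_top]
          refine setLIntegral_congr_fun measurableSet_Ioi fun t ht ↦ ?_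
          rw [ENNReal.ofReal_mul (by positivity)]
      _ < ∞ := ENNReal.mul_lt_top ENNReal.ofReal_lt_top (lintegral_Ioi_log_rpow_div_lt_top hT₀)

end Literature.Probability.RandomPlanarGeometry

end
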